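import Summits.ValiantsHypothesis.ValiantsHypothesis.Theses.FifoMatching
import Summits.ValiantsHypothesis.ValiantsHypothesis.Theorems.FifoMatchingNNLinearDegreeCofactorHardStubTopInternalComponent
import Summits.ValiantsHypothesis.ValiantsHypothesis.Theorems.FifoMatchingNNLinearDegreeCofactorHardStubLongRunInternalHard
import Summits.ValiantsHypothesis.ValiantsHypothesis.Theorems.FifoMatchingNNLinearDegreeCofactorHardShedWordAssemblyTight
import Literature.Computability.AlgebraicComplexity.NestFreeMatchingPoly

/-!
# Crux `FifoMatching.NNLinearDegreeCofactorHard` (stmt-ValiantsHypothesis-23918) — line `internal_cofactor` (skeleton)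

The crux (tenure expansion after `NNLowDegreeCofactorHard`, stmt-22993, closed PROVED 2026-08-27):
for some absolute `a`, for all `c` and all large `n`, every nonzero cofactor `h ∈ ℝ≥0[x]` with
`a · deg h ≤ n` leaves `NN_n` quasi-polynomially hard, `2^((log₂ n + c)^c) < L₊(NN_n · h) + L₊(h)`
(`NN_n` = the nest-free (FIFO) perfect-matching polynomial of `[2n]` in the arc variables `x_(i,j)`,
`L₊` = `complexity` over `ℝ≥0`; the `a = 0` instance is the load-bearing child `NNDivisionHard`).

WHERE THE LANDED ENGINE STOPS.  The freed-vertices line of 22993 (S1/S2/S3, all landed) and its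
sublinear extension (`nnDivisionHard_of_degree_budget`, `nnDivisionHard_of_vertexSupport_budget`) free
the whole vertex set `R` of one monomial of the cofactor and carve ONE defect-free run of `[2n] ∖ R`;
a cofactor of degree `n/a` whose top monomial under every vertex-potential order is spread over `2n/a`
vertices with all gaps `≈ a` leaves no run longer than `≈ a`, so the carved `NN_{n'}` is of constant
size.  This line keeps that engine for the case it owns (a long defect-free run, S2a) and isolates the
new content in ONE statement (S2b): INTERNAL cofactors (all arcs inside a small vertex set `R`,
`a·|R| ≤ 2n`) on an everywhere-dense `R`.

LEVER for S2b: **do not free the defects — keep them as defects.**  Every vertex outside `R` is covered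
exactly once by every monomial of `NN_n · p`, so balanced product terms of a monotone circuit still
respect ONE vertex split of `S = [2n] ∖ R` exactly; what is needed is a thick-queue spread measure
that stays spread when arcs touching `R` are exempt from the split constraint (defect-robust boundary
tests; excision of `R`-clusters longer than the queue thickness by pairing an interval internally, which
factorises `NN_n`).

Stubs (registered): `stub_topInternalComponent` (S1, S: citation-level from
`Theorems/FifoMatchingNNDivisionHardFewVerticesCofactor.lean`), `stub_longRunInternalHard` (S2a, M: the
landed free/carve/support-generic chain for a GIVEN run), `stub_denseInternalHard` (S2b, L: new).
Composition (no sorry outside the stubs): `NNLinearDegreeCofactorHard_of_line`, concluding the crux BY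
NAME.  All stub statements are self-contained (Mathlib + `nestFreeMatchingPoly` + `complexity`; no
line-local definitions; the run length `G = 2·((log₂ n + c)^c + log₂ n + 1)^6 + 12` is spelled out),
so a Theorems file can restate each verbatim and land it `--supports stmt-ValiantsHypothesis-23918`.
HONEST FRAMING: a skeleton; nothing here proves the crux, `NNDivisionHard`, `NNNotVP` or VP ≠ VNP;
monotone ≠ general (`Literature.Barriers.ValiantsHypothesis.MonotoneGap`).

WIRED 2026-08-28 (val-width-23918-c2; wiring only — every stub statement above is byte-identical to the
registered one, each `sorry` replaced by the ACCEPTED Theorems declaration proving it verbatim; sorries 3 → 0):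
S1 `stub_topInternalComponent` := `…Theorems.FifoMatching.NNLinearDegreeCofactorHard.InternalCofactor.stub_topInternalComponent`
(p590074, `Theorems/FifoMatchingNNLinearDegreeCofactorHardStubTopInternalComponent.lean`); S2a `stub_longRunInternalHard` :=
`…Theorems.FifoMatching.NNLinearDegreeCofactorHard.stub_longRunInternalHard` (p590091,
`Theorems/FifoMatchingNNLinearDegreeCofactorHardStubLongRunInternalHard.lean`); S2b `stub_denseInternalHard` :=
`⟨28, …InternalCofactor.denseInternalHard_twentyEight⟩` (p607827, `Theorems/FifoMatchingNNLinearDegreeCofactorHardShedWordAssemblyTight.lean`: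
μ* = shedWord priced at trace density 1/16, counts `avoidingCounts28`, `denseInternalHard_of_counts 28`).  With these the
registered composition `NNLinearDegreeCofactorHard_of_line` below is a sorry-free kernel term of the crux decl; the crux
itself was CLOSED·proved on the ledger by `…Theorems.FifoMatching.NNLinearDegreeCofactorHard.ShedWord.NNLinearDegreeCofactorHard_proof`
(p606802, a = 1024) — this workfile is the line's record, not a second closer.  VP ≠ VNP is NOT proved.
-/

noncomputable section

-- Sub = Summit single-conjunct layout: the duplicated namespace component is mandated by the tree.
set_option linter.dupNamespace false

namespace Summit.ValiantsHypothesis.ValiantsHypothesis.Cruxes.NNLinearDegreeCofactorHard.InternalCofactor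

open MvPolynomial Literature.Computability.AlgebraicComplexity
open scoped NNReal

/-- **S1 — the top vertex-potential component is an INTERNAL cofactor.**  For every nonzero
`h ∈ ℝ≥0[x_(i,j)]` there are a vertex set `R ⊆ [2n]`, `|R| ≤ 2·deg h`, and a nonzero `p` with
`deg p ≤ deg h`, every arc of every monomial of `p` having BOTH endpoints in `R`, and
`L₊(NN_n · p) ≤ L₊(NN_n · h)`.  Intended proof (citation-level): `p := top_w h` for the vertex-potential
weight `w = vertexWeight (2·deg h + 1)`; `exists_monomial_topComponent` (Theorems, FewVerticesCofactor)
gives `d₀ ∈ supp h` with all arcs of all monomials of `top_w h` inside `R := vertexSupport d₀`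
(`|R| ≤ 2·|supp d₀| ≤ 2·deg d₀ ≤ 2·deg h`); `NN_n` is `w`-homogeneous, so
`top_w (NN_n · h) = NN_n · top_w h` (`topComponent_mul`, `topComponent_eq_self_of_isWeightedHomogeneous`)
and `complexity_topComponent_le` bounds the complexity; `supp (top_w h) ⊆ supp h` bounds the degree.
[folklore] -/
theorem stub_topInternalComponent :
    ∀ (n : ℕ) (h : MvPolynomial (Fin (2 * n) × Fin (2 * n)) ℝ≥0), h ≠ 0 →
      ∃ R : Finset (Fin (2 * n)), R.card ≤ 2 * h.totalDegree ∧
        ∃ p : MvPolynomial (Fin (2 * n) × Fin (2 * n)) ℝ≥0, p ≠ 0 ∧ p.totalDegree ≤ h.totalDegree ∧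
          (∀ d ∈ p.support, ∀ e ∈ d.support, e.1 ∈ R ∧ e.2 ∈ R) ∧
          complexity (nestFreeMatchingPoly n ℝ≥0 * p) ≤ complexity (nestFreeMatchingPoly n ℝ≥0 * h) :=
  Summit.ValiantsHypothesis.ValiantsHypothesis.Theorems.FifoMatching.NNLinearDegreeCofactorHard.InternalCofactor.stub_topInternalComponent

/-- **S2a — a long defect-free run forces hardness (the landed engine).**  For every `c` and all
large `n`: if `[2n] ∖ R` contains a run of `G := 2·((log₂ n + c)^c + log₂ n + 1)^6 + 12` consecutive
vertices, then every nonzero INTERNAL cofactor `p` on `R` has `2^((log₂ n + c)^c) < L₊(NN_n · p)`.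
Intended proof: free `R` (arcs touching `R ↦ 1`, a projection; `p ↦ p(1) > 0` because all its arcs lie
inside `R`), so `L₊(η · NN_n^R) ≤ L₊(NN_n · p)`; carve an interval `I` of THAT run with both outer sides
even (`|I| ≥ G - 2`, the interval version of `FreedVertices.stub_carveInterval` /
`…StubCarveInterval`), obtaining `g` with `supp g = supp NN_{n'}`, `2n' ≥ G - 2`; then the
support-generic eventual bound (`exp_lower_bound_of_support_eq` / `exists_spread_measure_beating`:
`2^u < L₊(g)` with `u ≥ n'^{1/6} ≥ (log₂ n + c)^c + log₂ n + 1`). [folklore] -/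
theorem stub_longRunInternalHard :
    ∀ c : ℕ, ∃ n₀ : ℕ, ∀ n ≥ n₀, ∀ R : Finset (Fin (2 * n)),
      (∃ s : ℕ, s + (2 * ((Nat.log 2 n + c) ^ c + Nat.log 2 n + 1) ^ 6 + 12) ≤ 2 * n ∧
        ∀ j : Fin (2 * n), s ≤ j.val →
          j.val < s + (2 * ((Nat.log 2 n + c) ^ c + Nat.log 2 n + 1) ^ 6 + 12) → j ∉ R) →
      ∀ p : MvPolynomial (Fin (2 * n) × Fin (2 * n)) ℝ≥0, p ≠ 0 →
        (∀ d ∈ p.support, ∀ e ∈ d.support, e.1 ∈ R ∧ e.2 ∈ R) →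
          2 ^ ((Nat.log 2 n + c) ^ c) < complexity (nestFreeMatchingPoly n ℝ≥0 * p) :=
  Summit.ValiantsHypothesis.ValiantsHypothesis.Theorems.FifoMatching.NNLinearDegreeCofactorHard.stub_longRunInternalHard

/-- **S2b — dense small defect sets (THE NEW CONTENT).**  For some absolute `a`, for every `c` and
all large `n`: if `a·|R| ≤ 2n` and `[2n] ∖ R` has NO run of length `G` (as in S2a), then every nonzero
internal cofactor `p` on `R` with `a·deg p ≤ n` has `2^((log₂ n + c)^c) < L₊(NN_n · p)`.
Intended proof: do NOT free `R`.  (i) Rigidity with defects: `NN_n · p` has support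
`{M + A : M nest-free perfect matching, A ∈ supp p}`; every vertex of `S := [2n] ∖ R` is covered
exactly once by every monomial, so (as in `exists_balanced_vertex_split`) every balanced product term
`a·b ≤ NN_n · p` of the homogeneous structure theorem determines ONE split `I ⊆ S` such that no arc of
any `M` in its class joins `I` to `S ∖ I` — defects only at `R`.  (ii) A DEFECT-ROBUST thick-queue
spread measure `μ_R` on nest-free perfect matchings: mass `≤ 2^{-n^ε}` on every such class, for
balanced `I`; the landed measure (`…NNMonotoneHardMeasure`, thickness `L ≈ n^{4/5}`, boundary tests at
`≈ n^{1/5}` positions) must be made robust to a density-`1/a` defect set with all gaps `< G`: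
randomly shifted test positions, and EXCISION of `R`-clusters longer than the thickness by the
restriction «kill the arcs leaving an interval `J`, fix one nest-free pairing inside `J`», under which
`NN_n` factorises as `NN_left · NN_right` (no nest-free arc jumps over a paired interval), recursing on
the longer factor (`L₊` of a product on disjoint variables is `≥ L₊` of a factor up to `O(1)`, by
substituting `1`).  (iii) Union bound as in `exists_balanced_split_of_complexity`. [folklore] -/
theorem stub_denseInternalHard :
    ∃ a : ℕ, ∀ c : ℕ, ∃ n₀ : ℕ, ∀ n ≥ n₀, ∀ R : Finset (Fin (2 * n)), a * R.card ≤ 2 * n →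
      (¬ ∃ s : ℕ, s + (2 * ((Nat.log 2 n + c) ^ c + Nat.log 2 n + 1) ^ 6 + 12) ≤ 2 * n ∧
        ∀ j : Fin (2 * n), s ≤ j.val →
          j.val < s + (2 * ((Nat.log 2 n + c) ^ c + Nat.log 2 n + 1) ^ 6 + 12) → j ∉ R) →
      ∀ p : MvPolynomial (Fin (2 * n) × Fin (2 * n)) ℝ≥0, p ≠ 0 → a * p.totalDegree ≤ n →
        (∀ d ∈ p.support, ∀ e ∈ d.support, e.1 ∈ R ∧ e.2 ∈ R) →
          2 ^ ((Nat.log 2 n + c) ^ c) < complexity (nestFreeMatchingPoly n ℝ≥0 * p) :=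
  ⟨28, Summit.ValiantsHypothesis.ValiantsHypothesis.Theorems.FifoMatching.NNLinearDegreeCofactorHard.InternalCofactor.denseInternalHard_twentyEight⟩

/-- **The line: `NNLinearDegreeCofactorHard` from S1, S2a, S2b** (applied by name; the route's inlined
`NN_n` is definitionally `nestFreeMatchingPoly n ℝ≥0`).  Take `a` from S2b; given `c`, `n₀ := max` of
the thresholds of S2a and S2b; for `n ≥ n₀` and `h ≠ 0` with `a·deg h ≤ n`, S1 gives `R, p`
(`a·|R| ≤ 2a·deg h ≤ 2n`, `a·deg p ≤ a·deg h ≤ n`); case on whether `[2n] ∖ R` has a run of length `G`: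
S2a or S2b gives `2^((log₂ n + c)^c) < L₊(NN_n·p) ≤ L₊(NN_n·h) ≤ L₊(NN_n·h) + L₊(h)`. [folklore] -/
theorem NNLinearDegreeCofactorHard_of_line :
    Summit.ValiantsHypothesis.ValiantsHypothesis.Theses.FifoMatching.NNLinearDegreeCofactorHard := by
  obtain ⟨a, ha⟩ := stub_denseInternalHard
  refine ⟨a, fun c => ?_⟩
  obtain ⟨n₁, hn₁⟩ := stub_longRunInternalHard c
  obtain ⟨n₂, hn₂⟩ := ha c
  refine ⟨max n₁ n₂, fun n hn h hh hdeg => ?_⟩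
  obtain ⟨R, hR, p, hp, hpdeg, hint, hpc⟩ := stub_topInternalComponent n h hh
  have hRa : a * R.card ≤ 2 * n :=
    calc a * R.card ≤ a * (2 * h.totalDegree) := Nat.mul_le_mul_left a hR
      _ = 2 * (a * h.totalDegree) := by ring
      _ ≤ 2 * n := Nat.mul_le_mul_left 2 hdeg
  have hpa : a * p.totalDegree ≤ n := (Nat.mul_le_mul_left a hpdeg).trans hdeg
  have key : 2 ^ ((Nat.log 2 n + c) ^ c) < complexity (nestFreeMatchingPoly n ℝ≥0 * p) := by
    by_cases hrun : ∃ s : ℕ, s + (2 * ((Nat.log 2 n + c) ^ c + Nat.log 2 n + 1) ^ 6 + 12) ≤ 2 * n ∧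
        ∀ j : Fin (2 * n), s ≤ j.val →
          j.val < s + (2 * ((Nat.log 2 n + c) ^ c + Nat.log 2 n + 1) ^ 6 + 12) → j ∉ R
    · exact hn₁ n (le_of_max_le_left hn) R hrun p hp hint
    · exact hn₂ n (le_of_max_le_right hn) R hRa hrun p hp hpa hint
  show 2 ^ ((Nat.log 2 n + c) ^ c) <
    complexity (nestFreeMatchingPoly n ℝ≥0 * h) + complexity h
  calc 2 ^ ((Nat.log 2 n + c) ^ c) < complexity (nestFreeMatchingPoly n ℝ≥0 * p) := key
    _ ≤ complexity (nestFreeMatchingPoly n ℝ≥0 * h) := hpc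
    _ ≤ complexity (nestFreeMatchingPoly n ℝ≥0 * h) + complexity h := Nat.le_add_right _ _

end Summit.ValiantsHypothesis.ValiantsHypothesis.Cruxes.NNLinearDegreeCofactorHard.InternalCofactor

end
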